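import Summits.BirchSwinnertonDyer.BirchSwinnertonDyer.Theorems.KolyvaginRoadThreeSchneiderTamAtThreeHeightLogNumeratorLargePrimeSeries
import HarnessLib

/-!
# «The height is the logarithm of the numerator» — the EXACT second-order law at EVERY multiplicative
# prime `p ≥ 5`, part 1b: the equation, the Iwasawa logarithm and the `cosh` series one order further (generic `p`)

HONEST FRAMING (cell `bsd-stepL`, seat `bsd-stepL-tam3-p2` g5, WIDTH-LEVER second lane «closed-form Schneider
local factor … by Kodaira type (finite case table proved once)»; `--supports stmt-BirchSwinnertonDyer-19154 --as helper`):
THEOREMS ONLY, unconditional, route-independent (no Theses import); 0 definitions, 0 named facts, 0 sorry;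
nothing here proves the crux `SchneiderTamAtThree`, Schneider's conjecture or BSD. `p ≥ 5` twins of the `p = 3`
series lemmas of parts 1/3a/7 of the chain (g2/g3), with `p·‖z‖ ≤ 1` (level one) in place of `9‖z‖ ≤ 1` (level two):

* §4 (any `p`) `norm_pow_three_div_sq_sub_quartic_le_padic` — `x z² = 1 − a₁z − a₂z² − a₃z³ + O(‖x‖⁻²)` on `E₁(ℚ_p)`;
* §5 (`p ≥ 5`) `norm_padicLog_one_add_sub_sub_le_padic` — `‖log_p(1+u) − (u − u²/2)‖ ≤ ‖u‖³` on `‖u‖ ≤ p⁻¹`;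
* §6 (`p ≥ 5`) `norm_two_mul_coshOfSq_sub_cubic_le_padic` — `‖2(ch w − 1) − w − w²/12 − w³/360‖ ≤ p‖w‖⁴` on
  `‖w‖ ≤ p⁻²` (Legendre: `v_p((2n)!) ≤ (2n−1)/4`), and `norm_padicLog_two_mul_coshOfSq_sub_one_div_sub_le_padic` —
  `‖log_p(2(ch L − 1)/L) − (L/12 − L²/1440)‖ ≤ p‖L‖³` (`1/360 − 1/288 = −1/1440`; `‖1/360‖_p, ‖1/1440‖_p ≤ p`).

References: [SilvermanAEC2009] IV.1, VII.2.2; [Iwasawa1972PadicL] §4.4; tree: g2 `…DeepSeries` / `…DeepLog`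
(`p = 3` originals), g0 `…LargePrimeSeries`, ui-o2 `O2SigmaValuationLemmas` (`norm_coshOfSq_term`).
-/

noncomputable section

open scoped Classical Nat
open Filter Topology IsUltrametricDist PowerSeries
open WeierstrassCurve Literature.NumberTheory.EllipticCurves
open Literature.NumberTheory.EllipticCurves.SteinWuthrich2013
open Summit.BirchSwinnertonDyer.Uniform.UI.O2

namespace Summit.BirchSwinnertonDyer.Rank1Residual.X11b.RegMult.HeightLogNumerator

variable {p : ℕ} [hp : Fact p.Prime]

/-! ### §4 The equation to fourth order at any prime: `x z² = 1 − a₁z − a₂z² − a₃z³ + O(‖x‖⁻²)` on `E₁` -/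

/-- **`‖x³/y² − 1 − a₁·x/y + a₂·x²/y² − a₃·x³/y³‖_p ≤ ‖x‖_p⁻²`** for a point `(x, y)` with `‖x‖_p > 1` of a
`p`-integral Weierstrass equation (any prime `p`; the `p = 3` copy is `norm_pow_three_div_sq_sub_quartic_le`): multiplying
the equation by `y`, `x³y − y³ − a₁xy² + a₂x²y − a₃x³ = a₃(a₂x² + a₄x + a₆ − a₁xy − a₃y) − a₄xy − a₆y`, each term of norm
`≤ ‖x‖‖y‖ = ‖y‖³‖x‖⁻²`. In the parameter `z = −x/y`: `x z² = 1 − a₁z − a₂z² − a₃z³ + O(z⁴)`.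
[cite: SilvermanAEC2009, IV.1 and VII.2.2] -/
theorem norm_pow_three_div_sq_sub_quartic_le_padic {V : WeierstrassCurve ℚ_[p]} [V.IsIntegral ℤ_[p]]
    {x y : ℚ_[p]} (heq : V.toAffine.Equation x y) (hx : 1 < ‖x‖) :
    ‖x ^ 3 / y ^ 2 - 1 - V.a₁ * (x / y) + V.a₂ * (x / y) ^ 2 - V.a₃ * (x / y) ^ 3‖ ≤ ‖x‖⁻¹ ^ 2 := by
  obtain ⟨h₁, h₂, h₃, h₄, h₆⟩ := V.norm_coeffs_le_one
  obtain ⟨hsq, hxy⟩ := V.norm_sq_eq_norm_cube heq hx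
  rw [Affine.equation_iff] at heq
  have hx0 : 0 < ‖x‖ := one_pos.trans hx
  have hy1 : 1 < ‖y‖ := hx.trans hxy
  have hy0 : 0 < ‖y‖ := one_pos.trans hy1
  have hy0' : y ≠ 0 := norm_pos_iff.mp hy0
  have hy3 : y ^ 3 ≠ 0 := pow_ne_zero 3 hy0'
  have hnum : x ^ 3 * y - y ^ 3 - V.a₁ * x * y ^ 2 + V.a₂ * x ^ 2 * y - V.a₃ * x ^ 3 =
      V.a₃ * (V.a₂ * x ^ 2 + V.a₄ * x + V.a₆ - V.a₁ * x * y - V.a₃ * y) - V.a₄ * x * y - V.a₆ * y := by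
    linear_combination (V.a₃ - y) * heq
  have e : x ^ 3 / y ^ 2 - 1 - V.a₁ * (x / y) + V.a₂ * (x / y) ^ 2 - V.a₃ * (x / y) ^ 3 =
      (V.a₃ * (V.a₂ * x ^ 2 + V.a₄ * x + V.a₆ - V.a₁ * x * y - V.a₃ * y) - V.a₄ * x * y - V.a₆ * y) / y ^ 3 := by
    rw [← hnum, eq_div_iff hy3]
    field_simp
  rw [e, norm_div, norm_pow, div_le_iff₀ (pow_pos hy0 3)]
  have hrhs : ‖x‖⁻¹ ^ 2 * ‖y‖ ^ 3 = ‖x‖ * ‖y‖ := by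
    have : ‖y‖ ^ 3 = ‖x‖ ^ 3 * ‖y‖ := by rw [← hsq]; ring
    rw [this]; field_simp
  rw [hrhs]
  have hx1 : 1 ≤ ‖x‖ := hx.le
  have hy1' : 1 ≤ ‖y‖ := hy1.le
  have hxy' : ‖x‖ ≤ ‖y‖ := hxy.le
  have hxxy : ‖x‖ * ‖x‖ ≤ ‖x‖ * ‖y‖ := by gcongr
  have hyxy : ‖y‖ ≤ ‖x‖ * ‖y‖ := le_mul_of_one_le_left hy0.le hx1
  have hxle : ‖x‖ ≤ ‖x‖ * ‖y‖ := le_mul_of_one_le_right hx0.le hy1'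
  have h1le : (1 : ℝ) ≤ ‖x‖ * ‖y‖ := one_le_mul_of_one_le_of_one_le hx1 hy1'
  have hin : ‖V.a₂ * x ^ 2 + V.a₄ * x + V.a₆ - V.a₁ * x * y - V.a₃ * y‖ ≤ ‖x‖ * ‖y‖ := by
    refine (norm_sub_le_max₃ _ _).trans (max_le ((norm_sub_le_max₃ _ _).trans (max_le
      ((norm_add_le_max _ _).trans (max_le ((norm_add_le_max _ _).trans (max_le ?_ ?_)) ?_)) ?_)) ?_)
    · rw [norm_mul, norm_pow]
      calc ‖V.a₂‖ * ‖x‖ ^ 2 ≤ 1 * ‖x‖ ^ 2 := by gcongr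
        _ = ‖x‖ * ‖x‖ := by ring
        _ ≤ ‖x‖ * ‖y‖ := hxxy
    · rw [norm_mul]
      calc ‖V.a₄‖ * ‖x‖ ≤ 1 * ‖x‖ := by gcongr
        _ = ‖x‖ := one_mul _
        _ ≤ ‖x‖ * ‖y‖ := hxle
    · exact h₆.trans h1le
    · rw [norm_mul, norm_mul]
      calc ‖V.a₁‖ * ‖x‖ * ‖y‖ ≤ 1 * ‖x‖ * ‖y‖ := by gcongr
        _ = ‖x‖ * ‖y‖ := by ring
    · rw [norm_mul]
      calc ‖V.a₃‖ * ‖y‖ ≤ 1 * ‖y‖ := by gcongr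
        _ = ‖y‖ := one_mul _
        _ ≤ ‖x‖ * ‖y‖ := hyxy
  refine (norm_sub_le_max₃ _ _).trans (max_le ((norm_sub_le_max₃ _ _).trans (max_le ?_ ?_)) ?_)
  · rw [norm_mul]
    calc ‖V.a₃‖ * _ ≤ 1 * (‖x‖ * ‖y‖) := mul_le_mul h₃ hin (norm_nonneg _) zero_le_one
      _ = ‖x‖ * ‖y‖ := one_mul _
  · rw [norm_mul, norm_mul]
    calc ‖V.a₄‖ * ‖x‖ * ‖y‖ ≤ 1 * ‖x‖ * ‖y‖ := by gcongr
      _ = ‖x‖ * ‖y‖ := by ring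
  · rw [norm_mul]
    calc ‖V.a₆‖ * ‖y‖ ≤ 1 * ‖y‖ := by gcongr
      _ = ‖y‖ := one_mul _
      _ ≤ ‖x‖ * ‖y‖ := hyxy

/-! ### §5 The Iwasawa logarithm near `1` to second order at `p ≥ 5`: `‖log_p(1+u) − (u − u²/2)‖ ≤ ‖u‖³` -/

omit hp in
/-- `5^{n+1} > n + 3`. [folklore] -/
private theorem five_pow_succ_gt_add_three (n : ℕ) : n + 3 < 5 ^ (n + 1) := by
  induction n with
  | zero => norm_num
  | succ k ih => rw [pow_succ]; omega

/-- `v_p(n + 3) ≤ n` for `p ≥ 5`. [folklore] -/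
private theorem padicValNat_add_three_le (hp5 : 5 ≤ p) (n : ℕ) : padicValNat p (n + 3) ≤ n := by
  have hdvd : p ^ padicValNat p (n + 3) ∣ n + 3 := pow_padicValNat_dvd
  have hle : p ^ padicValNat p (n + 3) ≤ n + 3 := Nat.le_of_dvd (by omega) hdvd
  by_contra hgt
  have hge : n + 1 ≤ padicValNat p (n + 3) := by omega
  have h1 : 5 ^ (n + 1) ≤ p ^ (n + 1) := Nat.pow_le_pow_left hp5 _
  have h2 : p ^ (n + 1) ≤ p ^ padicValNat p (n + 3) := Nat.pow_le_pow_right hp.out.pos hge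
  have := five_pow_succ_gt_add_three n
  omega

/-- `‖1/(n+3)‖_p ≤ pⁿ` for `p ≥ 5`. [folklore] -/
private theorem norm_inv_natCast_add_three_le_padic (hp5 : 5 ≤ p) (n : ℕ) :
    ‖(((n + 3 : ℕ) : ℚ_[p]))⁻¹‖ ≤ (p : ℝ) ^ n := by
  have hp1 : (1 : ℝ) ≤ p := by exact_mod_cast hp.out.one_lt.le
  rw [norm_inv, Padic.norm_eq_zpow_neg_valuation (by exact_mod_cast (show (n + 3 : ℕ) ≠ 0 by omega)),
    Padic.valuation_natCast, zpow_neg, inv_inv, zpow_natCast]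
  exact pow_le_pow_right₀ hp1 (padicValNat_add_three_le hp5 n)

/-- **`‖log_p(1 + u) − (u − u²/2)‖_p ≤ ‖u‖_p³` for `‖u‖_p ≤ p⁻¹`, `p ≥ 5`**: the logarithmic series (Iwasawa;
`padicLog_eq_padicLogSeries`) with every term `uᵐ/m`, `m ≥ 3`, of norm `≤ p^{m−3}‖u‖ᵐ ≤ ‖u‖³` (as `p‖u‖ ≤ 1`).
The `p = 3` companion `norm_padicLog_one_add_sub_sub_le` has the extra factor `3`. [cite: Iwasawa1972PadicL, §4.4] -/
theorem norm_padicLog_one_add_sub_sub_le_padic (hp5 : 5 ≤ p) {u : ℚ_[p]} (hu : ‖u‖ ≤ (p : ℝ)⁻¹) :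
    ‖padicLog p (1 + u) - (u - u ^ 2 / 2)‖ ≤ ‖u‖ ^ 3 := by
  have hp1 : (1 : ℝ) < p := by exact_mod_cast hp.out.one_lt
  have hp0 : (0 : ℝ) < p := by positivity
  have hu1 : ‖u‖ < 1 := hu.trans_lt (inv_lt_one_of_one_lt₀ hp1)
  have h1y : ‖1 - (1 + u)‖ < 1 := by rwa [sub_add_cancel_left, norm_neg]
  rw [padicLog_eq_padicLogSeries h1y]
  have ht : ‖-u‖ < 1 := by rwa [norm_neg]
  have hsum := summable_padicLogSeries_term (p := p) ht
  have hser : padicLogSeries p (1 + u) = ∑' n : ℕ, -((-u) ^ (n + 1)) / (n + 1 : ℚ_[p]) := by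
    rw [padicLogSeries, sub_add_cancel_left]
  have hsplit := hsum.sum_add_tsum_nat_add 2
  have htwo : ∑ i ∈ Finset.range 2, -((-u) ^ (i + 1)) / ((i : ℚ_[p]) + 1) = u - u ^ 2 / 2 := by
    simp only [Finset.sum_range_succ, Finset.sum_range_zero]
    norm_num
    ring
  rw [hser, ← hsplit, htwo, add_sub_cancel_left]
  refine norm_tsum_le_of_forall_le_of_nonneg (by positivity) fun n ↦ ?_
  have e : -((-u) ^ (n + 2 + 1)) / (((n + 2 : ℕ) : ℚ_[p]) + 1) = -((-u) ^ (n + 3)) / ((n + 3 : ℕ) : ℚ_[p]) := by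
    push_cast; ring_nf
  rw [e, norm_div, norm_neg, norm_pow, norm_neg, div_eq_mul_inv, ← norm_inv]
  have hpu : (p : ℝ) * ‖u‖ ≤ 1 := by
    calc (p : ℝ) * ‖u‖ ≤ p * (p : ℝ)⁻¹ := by gcongr
      _ = 1 := mul_inv_cancel₀ hp0.ne'
  have hu0 : 0 ≤ ‖u‖ := norm_nonneg u
  calc ‖u‖ ^ (n + 3) * ‖(((n + 3 : ℕ) : ℚ_[p]))⁻¹‖ ≤ ‖u‖ ^ (n + 3) * (p : ℝ) ^ n := by
        gcongr; exact norm_inv_natCast_add_three_le_padic hp5 n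
    _ = ‖u‖ ^ 3 * ((p : ℝ) * ‖u‖) ^ n := by ring
    _ ≤ ‖u‖ ^ 3 * 1 ^ n := by gcongr
    _ = ‖u‖ ^ 3 := by ring

/-! ### §6 The `cosh` series to third order at `p ≥ 5`, and `log_p(2(ch L − 1)/L)` to second order -/

/-- Legendre for the `cosh` tail at `p ≥ 5`: `v_p((2(n+4))!) ≤ 2n + 1` (indeed `(p−1)·v_p(m!) < m`, so
`4·v < 2n + 8`). [folklore] -/
private theorem padicValNat_factorial_two_mul_add_four_le (hp5 : 5 ≤ p) (n : ℕ) :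
    padicValNat p (2 * (n + 4))! ≤ 2 * n + 1 := by
  have h := sub_one_mul_padicValNat_factorial_lt_of_ne_zero p (show 2 * (n + 4) ≠ 0 by omega)
  have h4 : 4 * padicValNat p (2 * (n + 4))! ≤ (p - 1) * padicValNat p (2 * (n + 4))! :=
    Nat.mul_le_mul_right _ (by omega)
  omega

/-- **`‖2(ch(w) − 1) − w − w²/12 − w³/360‖_p ≤ p‖w‖⁴` for `‖w‖_p ≤ p⁻²`, `p ≥ 5`**: each term `2wⁿ/(2n)!`,
`n ≥ 4`, has norm `‖w‖ⁿ p^{v_p((2n)!)} ≤ ‖w‖ⁿ p^{2n−7} ≤ p‖w‖⁴` (`p²‖w‖ ≤ 1`). The `p = 3` companion is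
`norm_two_mul_coshOfSq_sub_cubic_le` (`9‖w‖⁴` on `‖w‖ ≤ 3⁻²`). [folklore] -/
theorem norm_two_mul_coshOfSq_sub_cubic_le_padic (hp5 : 5 ≤ p) {w : ℚ_[p]} (hw : ‖w‖ ≤ ((p : ℝ)⁻¹) ^ 2) :
    ‖2 * (coshOfSq w - 1) - w - w ^ 2 / 12 - w ^ 3 / 360‖ ≤ (p : ℝ) * ‖w‖ ^ 4 := by
  have hp2 : p ≠ 2 := by omega
  have hp1 : (1 : ℝ) < p := by exact_mod_cast hp.out.one_lt
  have hp1' : (1 : ℝ) ≤ p := hp1.le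
  have hp0 : (0 : ℝ) < p := by positivity
  have h2 : ‖(2 : ℚ_[p])‖ = 1 := by
    simpa using Padic.norm_natCast_eq_one_iff.mpr ((Nat.coprime_primes hp.out Nat.prime_two).mpr hp2)
  set t : ℕ → ℚ_[p] := fun n => w ^ n / ((2 * n) ! : ℚ_[p]) with ht
  have hsum : Summable t := by
    refine Summable.of_norm_bounded
      (summable_geometric_of_lt_one (by positivity) (inv_lt_one_of_one_lt₀ hp1)) fun n => ?_
    exact norm_coshOfSq_term_le hp2 hw n
  have h0 : coshOfSq w = ∑' n, t n := rfl
  have hsplit := hsum.sum_add_tsum_nat_add 4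
  have hfour : ∑ i ∈ Finset.range 4, t i = 1 + w / 2 + w ^ 2 / 24 + w ^ 3 / 720 := by
    simp only [Finset.sum_range_succ, Finset.sum_range_zero, ht]
    norm_num [Nat.factorial]
  have e : 2 * (coshOfSq w - 1) - w - w ^ 2 / 12 - w ^ 3 / 360 =
      2 * (coshOfSq w - (1 + w / 2 + w ^ 2 / 24 + w ^ 3 / 720)) := by ring
  rw [e, norm_mul, h2, one_mul, h0, ← hsplit, hfour, add_sub_cancel_left]
  refine IsUltrametricDist.norm_tsum_le_of_forall_le_of_nonneg (by positivity) fun n ↦ ?_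
  have hw0 : 0 ≤ ‖w‖ := norm_nonneg w
  rw [ht]
  dsimp only
  rw [norm_coshOfSq_term]
  have hv : (padicValNat p (2 * (n + 4))! : ℤ) ≤ ((2 * n + 1 : ℕ) : ℤ) := by
    exact_mod_cast padicValNat_factorial_two_mul_add_four_le hp5 n
  have hpw : (p : ℝ) ^ 2 * ‖w‖ ≤ 1 := by
    calc (p : ℝ) ^ 2 * ‖w‖ ≤ (p : ℝ) ^ 2 * ((p : ℝ)⁻¹) ^ 2 := by gcongr
      _ = 1 := by field_simp
  calc ‖w‖ ^ (n + 4) * (p : ℝ) ^ (padicValNat p (2 * (n + 4))! : ℤ)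
      ≤ ‖w‖ ^ (n + 4) * (p : ℝ) ^ ((2 * n + 1 : ℕ) : ℤ) :=
        mul_le_mul_of_nonneg_left (zpow_le_zpow_right₀ hp1' hv) (pow_nonneg hw0 _)
    _ = ((p : ℝ) * ‖w‖ ^ 4) * ((p : ℝ) ^ 2 * ‖w‖) ^ n := by rw [zpow_natCast]; ring
    _ ≤ ((p : ℝ) * ‖w‖ ^ 4) * 1 ^ n := by gcongr
    _ = (p : ℝ) * ‖w‖ ^ 4 := by ring

/-- **`log_p(2(ch L − 1)/L) = L/12 − L²/1440 + O(p‖L‖³)`** for `0 < ‖L‖_p ≤ p⁻²`, `p ≥ 5`: with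
`u = 2(ch L − 1)/L − 1 = L/12 + L²/360 + D/L`, `‖D‖ ≤ p‖L‖⁴`, `‖u‖ ≤ ‖L‖`, `log_p(1+u) = u − u²/2 + O(‖u‖³)` and
`u² = L²/144 + O(p‖L‖³)`; `1/360 − 1/288 = −1/1440` and `‖1/360‖_p, ‖1/1440‖_p ≤ p`. The `p = 3` companion is
`norm_padicLog_two_mul_coshOfSq_sub_one_div_sub_le` (`81‖L‖³` on `‖L‖ ≤ 3⁻⁴`). [cite: Iwasawa1972PadicL, §4.4] -/
theorem norm_padicLog_two_mul_coshOfSq_sub_one_div_sub_le_padic (hp5 : 5 ≤ p) {L : ℚ_[p]} (hL0 : L ≠ 0)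
    (hL : ‖L‖ ≤ ((p : ℝ)⁻¹) ^ 2) :
    ‖padicLog p (2 * (coshOfSq L - 1) / L) - (L / 12 - L ^ 2 / 1440)‖ ≤ (p : ℝ) * ‖L‖ ^ 3 := by
  have hp2 : p ≠ 2 := by omega
  have hp3 : p ≠ 3 := by omega
  have hp1 : (1 : ℝ) < p := by exact_mod_cast hp.out.one_lt
  have hp1' : (1 : ℝ) ≤ p := hp1.le
  have hp0 : (0 : ℝ) < p := by positivity
  have hLn : 0 < ‖L‖ := norm_pos_iff.mpr hL0
  have hLp : ‖L‖ ≤ (p : ℝ)⁻¹ := by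
    refine hL.trans ?_
    rw [sq]; exact mul_le_of_le_one_left (inv_nonneg.mpr hp0.le) (inv_le_one_of_one_le₀ hp1')
  have hpL : (p : ℝ) * ‖L‖ ≤ 1 := by
    calc (p : ℝ) * ‖L‖ ≤ p * (p : ℝ)⁻¹ := by gcongr
      _ = 1 := mul_inv_cancel₀ hp0.ne'
  -- units and the two non-units `1/360`, `1/1440` (`‖·‖ ≤ p` at `p ≥ 5`)
  have hunit : ∀ m : ℕ, Nat.Coprime p m → ‖((m : ℚ_[p]))⁻¹‖ = 1 := fun m hm => by
    rw [norm_inv, Padic.norm_natCast_eq_one_iff.mpr hm, inv_one]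
  have hcop2 : Nat.Coprime p 2 := (Nat.coprime_primes hp.out Nat.prime_two).mpr hp2
  have hcop3 : Nat.Coprime p 3 := (Nat.coprime_primes hp.out Nat.prime_three).mpr hp3
  have h2n : ‖(2 : ℚ_[p])‖ = 1 := by simpa using Padic.norm_natCast_eq_one_iff.mpr hcop2
  have h12i : ‖(12 : ℚ_[p])⁻¹‖ = 1 := by
    have h12 : Nat.Coprime p 12 := by
      rw [show (12 : ℕ) = 2 ^ 2 * 3 by norm_num]
      exact (Nat.Coprime.pow_right 2 hcop2).mul_right hcop3
    simpa using hunit 12 h12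
  have h72i : ‖(72 : ℚ_[p])⁻¹‖ = 1 := by
    have h72 : Nat.Coprime p 72 := by
      rw [show (72 : ℕ) = 2 ^ 3 * 3 ^ 2 by norm_num]
      exact (Nat.Coprime.pow_right 3 hcop2).mul_right (Nat.Coprime.pow_right 2 hcop3)
    simpa using hunit 72 h72
  have h5i : ‖(5 : ℚ_[p])⁻¹‖ ≤ p := by
    rcases eq_or_ne p 5 with h5 | h5
    · subst h5
      have : ‖((5 : ℕ) : ℚ_[5])‖ = ((5 : ℕ) : ℝ)⁻¹ := Padic.norm_p (p := 5)
      rw [norm_inv]; push_cast at this; rw [this, inv_inv]; norm_num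
    · have hcop5 : Nat.Coprime p 5 := (Nat.coprime_primes hp.out (by norm_num)).mpr h5
      have := hunit 5 hcop5; push_cast at this; rw [this]; exact hp1'
  have h360i : ‖(360 : ℚ_[p])⁻¹‖ ≤ p := by
    rw [show (360 : ℚ_[p]) = 72 * 5 by norm_num, mul_inv, norm_mul, h72i, one_mul]; exact h5i
  set D : ℚ_[p] := 2 * (coshOfSq L - 1) - L - L ^ 2 / 12 - L ^ 3 / 360 with hDdef
  have hD : ‖D‖ ≤ (p : ℝ) * ‖L‖ ^ 4 := norm_two_mul_coshOfSq_sub_cubic_le_padic hp5 hL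
  clear_value D
  -- `u = L/12 + E`, `E = L²/360 + D/L`, `‖E‖ ≤ p‖L‖²`
  set u : ℚ_[p] := 2 * (coshOfSq L - 1) / L - 1 with hudef
  have hu_eq : u = L / 12 + (L ^ 2 / 360 + D / L) := by
    rw [hudef, hDdef]; field_simp; ring
  have hEn : ‖L ^ 2 / 360 + D / L‖ ≤ (p : ℝ) * ‖L‖ ^ 2 := by
    refine (norm_add_le_max _ _).trans (max_le ?_ ?_)
    · rw [div_eq_mul_inv, norm_mul, norm_pow, mul_comm]
      exact mul_le_mul_of_nonneg_right h360i (by positivity)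
    · rw [norm_div, div_le_iff₀ hLn]
      calc ‖D‖ ≤ (p : ℝ) * ‖L‖ ^ 4 := hD
        _ = (p : ℝ) * ‖L‖ ^ 2 * ‖L‖ * ‖L‖ := by ring
        _ ≤ (p : ℝ) * ‖L‖ ^ 2 * 1 * ‖L‖ := by gcongr; exact hLp.trans (inv_le_one_of_one_le₀ hp1')
        _ = (p : ℝ) * ‖L‖ ^ 2 * ‖L‖ := by ring
  have hL12 : ‖L / 12‖ = ‖L‖ := by rw [div_eq_mul_inv, norm_mul, h12i, mul_one]
  have hpL2 : (p : ℝ) * ‖L‖ ^ 2 ≤ ‖L‖ := by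
    calc (p : ℝ) * ‖L‖ ^ 2 = ((p : ℝ) * ‖L‖) * ‖L‖ := by ring
      _ ≤ 1 * ‖L‖ := by gcongr
      _ = ‖L‖ := one_mul _
  have hun : ‖u‖ ≤ ‖L‖ := by
    rw [hu_eq]
    exact (norm_add_le_max _ _).trans (max_le hL12.le (hEn.trans hpL2))
  have hup : ‖u‖ ≤ (p : ℝ)⁻¹ := hun.trans hLp
  have hlog := norm_padicLog_one_add_sub_sub_le_padic hp5 hup
  have h1u : 1 + u = 2 * (coshOfSq L - 1) / L := by rw [hudef]; ring
  rw [h1u] at hlog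
  -- `u² = (L/12)² + E(2·L/12 + E)`, `1/360 − 1/288 = −1/1440`
  have hfin : padicLog p (2 * (coshOfSq L - 1) / L) - (L / 12 - L ^ 2 / 1440) =
      (padicLog p (2 * (coshOfSq L - 1) / L) - (u - u ^ 2 / 2)) + D / L -
        (2 : ℚ_[p])⁻¹ * ((L ^ 2 / 360 + D / L) * (2 * (L / 12) + (L ^ 2 / 360 + D / L))) := by
    rw [hu_eq]; ring
  rw [hfin]
  have hL3 : 0 ≤ ‖L‖ ^ 3 := by positivity
  refine (norm_sub_le_max₃ _ _).trans (max_le ((norm_add_le_max _ _).trans (max_le (hlog.trans ?_) ?_)) ?_)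
  · calc ‖u‖ ^ 3 ≤ ‖L‖ ^ 3 := by gcongr
      _ = 1 * ‖L‖ ^ 3 := (one_mul _).symm
      _ ≤ (p : ℝ) * ‖L‖ ^ 3 := by gcongr
  · rw [norm_div, div_le_iff₀ hLn]
    calc ‖D‖ ≤ (p : ℝ) * ‖L‖ ^ 4 := hD
      _ = (p : ℝ) * ‖L‖ ^ 3 * ‖L‖ := by ring
  · rw [norm_mul, norm_inv, h2n, inv_one, one_mul, norm_mul]
    have h2 : ‖2 * (L / 12) + (L ^ 2 / 360 + D / L)‖ ≤ ‖L‖ := by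
      refine (norm_add_le_max _ _).trans (max_le ?_ (hEn.trans hpL2))
      rw [norm_mul, h2n, one_mul, hL12]
    calc ‖L ^ 2 / 360 + D / L‖ * ‖2 * (L / 12) + (L ^ 2 / 360 + D / L)‖ ≤ ((p : ℝ) * ‖L‖ ^ 2) * ‖L‖ := by
          gcongr
      _ = (p : ℝ) * ‖L‖ ^ 3 := by ring

end Summit.BirchSwinnertonDyer.Rank1Residual.X11b.RegMult.HeightLogNumerator

end
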